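import Literature.NumberTheory.EllipticCurves.NewformsRealCoefficients
import Literature.NumberTheory.EllipticCurves.AtkinLehnerInvolutionsProofs
import Literature.NumberTheory.EllipticCurves.AtkinLehnerNewSubspaceProofs
import Literature.NumberTheory.EllipticCurves.AtkinLehnerProductProofs
import Literature.NumberTheory.EllipticCurves.CongruenceNumber
import HarnessLib

/-!
# Atkin–Lehner involutions commute with Shimura's `ε` (`f ↦ conj f(−z̄)`): `w_Q` preserves real-coefficient forms

Summit `BirchSwinnertonDyer`, sub-problem `BirchSwinnertonDyer`, route `ManinLocalTwoThree`; width seat `bsd-line-manin23-p2`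
(gen 9), `--supports` the crux C3 `ManinPrimeToThreeAtNine` (stmt-BirchSwinnertonDyer-22968).  TOOL for the comparison
`M^G ≤ S^R ⊗ ℤ[ζ₃]` of desc's Conway–Norton and Ramanujan lattices at `3` (sibling file
`ManinLocalTwoThreeConwayNortonLeRamanujan`): the one analytic input there is that every Atkin–Lehner involution maps
forms with REAL Fourier coefficients to forms with real Fourier coefficients.

PROVED here (sorry-free):

* `J_mul_atkinLehnerW_mul_J` — `J w(Q) J = γ w(Q)` with `γ ∈ Γ₀(N)` (`J = diag(−1,1)`, `w(Q) = (Qx, y; N, Q)`: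
  `J w(Q) J = (Qx, −y; −N, Q)` is again an Atkin–Lehner matrix for `Q`, tree `exists_gamma0_mul_atkinLehnerW_eq`);
* **`epsConj0_atkinLehnerInvolution`** — `(w_Q f)^ε = w_Q (f^ε)` on `S_k(Γ₀(N))` for `Q ∥ N` (Shimura's `f^ε = f ∣ J`,
  tree `epsConj0`); `epsConj0_atkinLehnerInvolutionAt` — the same for `w_{Q_q}`, `q ∣ N` prime;
* `epsConj0_eq_self_of_mem_integralCuspForms0` — integral forms are `ε`-fixed;
* **`conj_cuspCoeff_atkinLehnerInvolutionAt_of_mem_integralCuspForms0`** — for `s ∈ S₂(Γ₀(N); ℤ)` (any weight `k` in fact: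
  `_of_conj_cuspCoeff`), all Fourier coefficients of `w_{Q_q} s` are REAL.

Elementary slash-operator bookkeeping (Shimura 1971, (3.5.19) and proof of Thm. 3.48; Knapp 1993, Lemma 9.24).  BSD is not
proved by this; Manin's conjecture is not proved by this.
-/

set_option autoImplicit false
set_option linter.dupNamespace false

noncomputable section

open scoped MatrixGroups ModularForm ComplexConjugate
open CongruenceSubgroup Matrix.SpecialLinearGroup UpperHalfPlane
open Literature.NumberTheory.EllipticCurves Literature.NumberTheory.EllipticCurves.ModularForms

namespace Summit.BirchSwinnertonDyer.BirchSwinnertonDyer.Theorems.ManinLocalTwoThree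

variable {N : ℕ} [NeZero N] {k : ℤ}

omit [NeZero N] in
/-- **`J w(Q) J = γ w(Q)` for some `γ ∈ Γ₀(N)`** (`Q ∥ N`): with `w(Q) = (Qx, y; N, Q)`, `J w(Q) J = (Qx, −y; −N, Q)` has
the Atkin–Lehner shape `(Q·x, −y; N·(−1), Q·1)` with `Q x · 1 − (N/Q)(−y)(−1) = Qx − (N/Q) y = 1`. -/
theorem J_mul_atkinLehnerW_mul_J (Q : ℕ) [NeZero Q] (hQN : Q ∣ N) (hc : Nat.Coprime Q (N / Q)) :
    ∃ γ ∈ Gamma0 N, J * glCast (atkinLehnerW N Q : GL (Fin 2) ℚ) * J =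
      (mapGL ℝ γ : GL (Fin 2) ℝ) * glCast (atkinLehnerW N Q : GL (Fin 2) ℚ) := by
  obtain ⟨M, hM⟩ := hQN
  have hMQ : N / Q = M := by rw [hM, Nat.mul_div_cancel_left M (NeZero.pos Q)]
  have hb := atkinLehnerSL_bezout N Q hc
  rw [hMQ] at hb
  obtain ⟨γ, hγ, hmat⟩ := exists_gamma0_mul_atkinLehnerW_eq N Q hM hc
    ((atkinLehnerSL N Q) 0 0) (-(atkinLehnerSL N Q) 0 1) (-1) 1 (by linear_combination hb)
  refine ⟨γ, hγ, ?_⟩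
  refine Units.ext ?_
  rw [hmat, Matrix.GeneralLinearGroup.coe_mul, Matrix.GeneralLinearGroup.coe_mul,
    val_glCast_atkinLehnerW N Q ⟨M, hM⟩ hc, val_J]
  ext i j
  fin_cases i <;> fin_cases j <;> simp [Matrix.mul_apply, Fin.sum_univ_two]

/-- **`ε` commutes with the Atkin–Lehner involutions**: `(w_Q f)^ε = w_Q (f^ε)` for `Q ∥ N`.  Proof:
`w_Q f = Q^{1−k/2} · f ∣ w(Q)`, `f^ε = f ∣ J`, the scalar is real, and `w(Q) J = J · (J w(Q) J) = J γ w(Q)` with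
`γ ∈ Γ₀(N)` acting trivially on `f ∣ J ∈ S_k(Γ₀(N))`. -/
theorem epsConj0_atkinLehnerInvolution (Q : ℕ) [NeZero Q] (hQN : Q ∣ N) (hc : Nat.Coprime Q (N / Q))
    (f : CuspForm (Gamma0 N) k) :
    epsConj0 (atkinLehnerInvolution N k Q f) = atkinLehnerInvolution N k Q (epsConj0 f) := by
  obtain ⟨γ, hγ, hJ⟩ := J_mul_atkinLehnerW_mul_J (N := N) Q hQN hc
  apply DFunLike.coe_injective
  rw [coe_epsConj0, atkinLehnerInvolution_apply_eq_slash N k Q hQN hc f,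
    atkinLehnerInvolution_apply_eq_slash N k Q hQN hc (epsConj0 f), coe_epsConj0, ModularForm.smul_slash, σ_ofReal,
    ← SlashAction.slash_mul, ← SlashAction.slash_mul]
  congr 1
  -- `w(Q) * J = J * (J w(Q) J) = J * γ * w(Q)`
  have hWJ : glCast (atkinLehnerW N Q : GL (Fin 2) ℚ) * J = J * ((mapGL ℝ γ : GL (Fin 2) ℝ) *
      glCast (atkinLehnerW N Q : GL (Fin 2) ℚ)) := by
    rw [← hJ, ← mul_assoc, ← mul_assoc, J_mul_J, one_mul]
  rw [hWJ, SlashAction.slash_mul, SlashAction.slash_mul, SlashAction.slash_mul, ← coe_epsConj0,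
    SlashInvariantFormClass.slash_action_eq (epsConj0 f) (mapGL ℝ γ) (Subgroup.mem_map_of_mem _ hγ)]

/-- The same for `w_{Q_q}`, `q` a prime dividing `N`. -/
theorem epsConj0_atkinLehnerInvolutionAt {q : ℕ} (hq : q.Prime) (hqN : q ∣ N) (f : CuspForm (Gamma0 N) k) :
    epsConj0 (atkinLehnerInvolutionAt N k q f) = atkinLehnerInvolutionAt N k q (epsConj0 f) := by
  haveI : NeZero (q ^ N.factorization q) := ⟨(Nat.ordProj_pos N q).ne'⟩
  obtain ⟨hQN, hcQ⟩ := ordProj_dvd_and_coprime N (Nat.mem_primeFactors.mpr ⟨hq, hqN, NeZero.ne N⟩)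
  rw [atkinLehnerInvolutionAt_eq (N := N) (k := k) (p := q) rfl]
  exact epsConj0_atkinLehnerInvolution (q ^ N.factorization q) hQN hcQ f

/-- Integral forms are `ε`-fixed (their Fourier coefficients are real). -/
theorem epsConj0_eq_self_of_mem_integralCuspForms0 {s : CuspForm (Gamma0 N) k} (hs : s ∈ integralCuspForms0 N k) :
    epsConj0 s = s := by
  rw [epsConj0_eq_self_iff]
  intro n
  obtain ⟨z, hz⟩ := hs n
  rw [← hz, map_intCast]

/-- `w_{Q_q}` maps `ε`-fixed forms to `ε`-fixed forms. -/
theorem epsConj0_atkinLehnerInvolutionAt_eq_self {q : ℕ} (hq : q.Prime) (hqN : q ∣ N) {s : CuspForm (Gamma0 N) k}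
    (hs : epsConj0 s = s) : epsConj0 (atkinLehnerInvolutionAt N k q s) = atkinLehnerInvolutionAt N k q s := by
  rw [epsConj0_atkinLehnerInvolutionAt hq hqN, hs]

/-- **The Fourier coefficients of `w_{Q_q} s` are real for every integral `s`** (`q ∣ N` prime). -/
theorem conj_cuspCoeff_atkinLehnerInvolutionAt_of_mem_integralCuspForms0 {q : ℕ} (hq : q.Prime) (hqN : q ∣ N)
    {s : CuspForm (Gamma0 N) k} (hs : s ∈ integralCuspForms0 N k) (n : ℕ) :
    conj (cuspCoeff (atkinLehnerInvolutionAt N k q s) n) = cuspCoeff (atkinLehnerInvolutionAt N k q s) n :=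
  (epsConj0_eq_self_iff _).mp
    (epsConj0_atkinLehnerInvolutionAt_eq_self hq hqN (epsConj0_eq_self_of_mem_integralCuspForms0 hs)) n

end Summit.BirchSwinnertonDyer.BirchSwinnertonDyer.Theorems.ManinLocalTwoThree

end
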